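import Literature.NumberTheory.PAdicHodge.AinfWeierstrassOmegaPeriod
import Literature.NumberTheory.EllipticCurves.FormalGroupQuasiPeriodMulDefect
import HarnessLib

/-!
# The η-period `∫_t η ∈ B_dR⁺(F)` of a Tate-module point of the Weierstrass formal group, WITHOUT Banach spaces

Topic `Literature/NumberTheory/PAdicHodge`; sequel of `AinfWeierstrassOmegaPeriod` (the ω-period `∫_t ω = log_W([t])`) and of
`EllipticCurves/FormalGroupQuasiPeriodMulDefect` (the quasi-period function `η₀ = ∫(xω − dz/z²)`, its integral addition
cocycle `C₀` and multiplication defects `R_n`, `η₀([n]X) = nη₀(X) + R_n(X)`). For an integral Weierstrass equation `W/ℤ`, a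
prime `p`, a `p`-adic field `F` and a `p`-power-compatible sequence `t = (uᵢ)` of points of `Ŵ(𝔪_{ℂ_F})` (`[p]u_{i+1} = uᵢ`,
`u₀ = 0`), Colmez's second period `∫_t η = lim_n pⁿ η₀(ûₙ)` (Colmez 1992 §2; the limit is in the Fréchet topology of
`B_dR⁺`) is, by the telescoping identity `pⁿη₀(ûₙ) = η₀([pⁿ]ûₙ) − Σ_{j<n} p^{n−1−j} R_p([pʲ]ûₙ)`, equal to

  **`∫_t η = η₀(T₀) − Σ_{i≥1} p^{i−1} R_p(Tᵢ)`**,   `Tᵢ := [t⁽ⁱ⁾]` = Fontaine's element of the shifted sequence `(u_{n+i})ₙ`,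

whose first term is a `ξ`-adic evaluation on `Fil¹B_dR⁺` (`T₀ = [t] ∈ ker θ`, exactly as `∫_t ω`) and whose second term is a
`(p, ξ)`-adically convergent series of INTEGRAL elements of `𝔸_inf(F)` (`R_p ∈ ℤ⟦X⟧`, `Tᵢ ∈ 𝔫 = θ⁻¹(𝔪_{ℂ_F})`). This file
takes that closed form as the DEFINITION and proves what does not need the additivity bookkeeping:

* §1 `etaSeries` (`η₀` over the discrete coefficient ring `ℚ`), `mulDefectInt W n ∈ ℤ⟦X⟧` (an integral `R_n`, from
  `exists_map_eq_formalQuasiPeriodMulDefect`);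
* §2 `etaPeriodMain t = η₀(T₀)` and its `Γ_F`-equivariance;
* §3 the shifted sequences: `torsionLiftShift t i = Tᵢ`, `θ(Tᵢ) = uᵢ` (`theta_torsionLiftShift`), `Tᵢ ∈ 𝔫`, **`[p]T_{i+1} = Tᵢ`**
  (`mulP_torsionLiftShiftPt`), `σTᵢ = Tᵢ(σt)`;
* §4 the correction `etaCorr t = Σ_{i≥1} p^{i−1}R_p(Tᵢ) ∈ 𝔸_inf` (limit of the partial sums, `(p,ξ)`-adically) and its equivariance;
* §5 **`etaPeriod t := η₀(T₀) − ι(etaCorr t) ∈ B_dR⁺`** and **`gal_etaPeriod : σ(∫_t η) = ∫_{σt} η`**.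

Additivity in `t` (from `formalQuasiPeriodMulDefect_cocycle`: `Σ_{i≤n} p^{i−1}(C₀(T_{i−1},T′_{i−1}) − pC₀(Tᵢ,T′ᵢ))` telescopes) and
`θ(∫_t η) = −Σ_{i≥1} p^{i−1} R_p(uᵢ)` are the sequel. BSD context: crux K★ `stmt-BirchSwinnertonDyer-22226`, hDR sector (iii): the
second, Fil¹-transverse de Rham period of `V_pŴ`; BSD is not proved by any of this.

## References
* P. Colmez, *Périodes p-adiques des variétés abéliennes*, Math. Ann. 292 (1992), §2. [Colmez1992PeriodesAbeliennes]
* N. M. Katz, *Crystalline cohomology, Dieudonné modules, and Jacobi sums* (1981), §5.1. [Katz1981CrystallineDieudonne]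
* J.-M. Fontaine, *Le corps des périodes p-adiques*, Astérisque 223 (1994), Exp. II §1.2, §1.5. [FontaineAsterisque223III]
-/

noncomputable section

open Ideal Filter Topology Field WittVector MvPowerSeries

namespace Literature.NumberTheory.PAdicHodge

open Literature.NumberTheory.GaloisRepresentations
open Literature.NumberTheory.GaloisRepresentations.IsNonarchimedeanLocalField
open Literature.NumberTheory.GaloisRepresentations.LubinTate

namespace AinfTop

variable {F : Type} [Field F] [ValuativeRel F] [TopologicalSpace F] [IsNonarchimedeanLocalField F] [CharZero F]
  {p : ℕ} [Fact p.Prime] [Fact (¬ IsUnit (p : integerC F))]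
  [IsAdicComplete (Ideal.span {(p : integerC F)}) (integerC F)]
  {hθ : Function.Surjective (fontaineTheta (integerC F) p)}
  (W : WeierstrassCurve ℤ)

/-! ## §1 The series: `η₀` over `ℚ`, and an integral multiplication defect `R_n ∈ ℤ⟦X⟧` -/

/-- **The quasi-period function `η₀ ∈ ℚ⟦X⟧` of `W`** over the discrete coefficient ring `RatCoeff`.
[cite: Katz1981CrystallineDieudonne, §5.1] -/
def etaSeries (W : WeierstrassCurve ℤ) : PowerSeries RatCoeff :=
  PowerSeries.map RatCoeff.of.toRingHom (W.map (Int.castRingHom ℚ)).formalQuasiPeriod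

omit [CharZero F] [Fact p.Prime] [Fact (¬ IsUnit (p : integerC F))]
  [IsAdicComplete (Ideal.span {(p : integerC F)}) (integerC F)] in
/-- `η₀(0) = 0`. [cite: Katz1981CrystallineDieudonne, §5.1] -/
theorem constantCoeff_etaSeries : PowerSeries.constantCoeff (etaSeries W) = 0 := by
  rw [etaSeries, ← PowerSeries.coeff_zero_eq_constantCoeff_apply, PowerSeries.coeff_map,
    PowerSeries.coeff_zero_eq_constantCoeff_apply, WeierstrassCurve.constantCoeff_formalQuasiPeriod, map_zero]

/-- **An integral multiplication defect `R_n ∈ ℤ⟦X⟧`** with `R_n ↦ Σ_{k<n} C₀([k]X, X)` in `ℚ⟦X⟧`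
(`exists_map_eq_formalQuasiPeriodMulDefect` along `ℤ ↪ ℚ`). [cite: Katz1981CrystallineDieudonne, §5.1] -/
def mulDefectInt (W : WeierstrassCurve ℤ) (n : ℕ) : PowerSeries ℤ :=
  Classical.choose (W.exists_map_eq_formalQuasiPeriodMulDefect (φ := Int.castRingHom ℚ) Int.cast_injective n)

omit [CharZero F] [Fact p.Prime] [Fact (¬ IsUnit (p : integerC F))]
  [IsAdicComplete (Ideal.span {(p : integerC F)}) (integerC F)] in
/-- `R_n ⊗ ℚ = Σ_{k<n} C₀([k]X, X)`. [cite: Katz1981CrystallineDieudonne, §5.1] -/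
theorem map_mulDefectInt (n : ℕ) :
    PowerSeries.map (Int.castRingHom ℚ) (mulDefectInt W n) = (W.map (Int.castRingHom ℚ)).formalQuasiPeriodMulDefect n :=
  Classical.choose_spec (W.exists_map_eq_formalQuasiPeriodMulDefect (φ := Int.castRingHom ℚ) Int.cast_injective n)

omit [CharZero F] [Fact p.Prime] [Fact (¬ IsUnit (p : integerC F))]
  [IsAdicComplete (Ideal.span {(p : integerC F)}) (integerC F)] in
/-- `R_n(0) = 0` (each `C₀([k]X, X)` has no constant term). [cite: Katz1981CrystallineDieudonne, §5.1] -/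
theorem constantCoeff_mulDefectInt (n : ℕ) : PowerSeries.constantCoeff (mulDefectInt W n) = 0 := by
  apply Int.cast_injective (α := ℚ)
  have h := congrArg PowerSeries.constantCoeff (map_mulDefectInt W n)
  rw [← PowerSeries.coeff_zero_eq_constantCoeff_apply, PowerSeries.coeff_map, PowerSeries.coeff_zero_eq_constantCoeff_apply,
    eq_intCast] at h
  rw [Int.cast_zero, h, WeierstrassCurve.formalQuasiPeriodMulDefect, map_sum]
  refine Finset.sum_eq_zero fun k _ => ?_
  exact MvPowerSeries.constantCoeff_subst_eq_zero
    (Literature.NumberTheory.EllipticCurves.hasSubst_pair_X ((W.map (Int.castRingHom ℚ)).constantCoeff_formalMul k))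
    (fun i => by fin_cases i; exacts [(W.map (Int.castRingHom ℚ)).constantCoeff_formalMul k, PowerSeries.constantCoeff_X])
    (W.map (Int.castRingHom ℚ)).constantCoeff_formalQuasiPeriodCocycle

/-! ## §2 The main term `η₀(T₀)` -/

/-- **The main term `η₀([t]) ∈ B_dR⁺(F)`** of the η-period: the quasi-period function evaluated `ξ`-adically at Fontaine's
element `[t] ∈ Fil¹`. [cite: Colmez1992PeriodesAbeliennes, §2] -/
def etaPeriodMain (hθ : Function.Surjective (fontaineTheta (integerC F) p)) (t : ℕ → (maxNilIdealC F).toIdeal)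
    (ht0 : (t 0 : CBall F) = 0) (htp : ∀ n, mulPC F p W (t (n + 1)) = t n) : BdRPlusTop F p :=
  (evalPt₁ (BdRPlusTop.filOne F p) (etaSeries W) (constantCoeff_etaSeries W) (torsionLiftFil W hθ t ht0 htp) :
    BdRPlusTop F p)

/-- **`σ(η₀([t])) = η₀([σt])`.** [cite: FontaineAsterisque223III, Exp. II §1.5.4] -/
theorem gal_etaPeriodMain (σ : absoluteGaloisGroup F) {t : ℕ → (maxNilIdealC F).toIdeal} (ht0 : (t 0 : CBall F) = 0)
    (htp : ∀ n, mulPC F p W (t (n + 1)) = t n) :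
    BdRPlusTop.gal F p σ (etaPeriodMain W hθ t ht0 htp) =
      etaPeriodMain W hθ (galSeq F σ t) (coe_galSeq_zero σ ht0) (mulPC_galSeq W hθ σ htp) := by
  rw [etaPeriodMain, etaPeriodMain, BdRPlusTop.gal_evalPt₁]
  congr 2
  exact Subtype.ext (gal_torsionLiftFil W σ ht0 htp)

/-! ## §3 The shifted sequences and their Fontaine elements `Tᵢ = [t⁽ⁱ⁾]` -/

variable (F) in
/-- The shifted sequence `t⁽ⁱ⁾ = (u_{n+i})ₙ`. [cite: FontaineAsterisque223III, Exp. II §1.2.2] -/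
def shiftSeq (t : ℕ → (maxNilIdealC F).toIdeal) (i : ℕ) (n : ℕ) : (maxNilIdealC F).toIdeal := t (n + i)

omit [CharZero F] [Fact p.Prime] [Fact (¬ IsUnit (p : integerC F))]
  [IsAdicComplete (Ideal.span {(p : integerC F)}) (integerC F)] in
/-- The shifted sequence is `[p]`-compatible. [cite: FontaineAsterisque223III, Exp. II §1.2.2] -/
theorem shiftSeq_compat {t : ℕ → (maxNilIdealC F).toIdeal} (htp : ∀ n, mulPC F p W (t (n + 1)) = t n) (i : ℕ) :
    ∀ n, mulPC F p W (shiftSeq F t i (n + 1)) = shiftSeq F t i n := fun n => by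
  simp only [shiftSeq, Nat.add_right_comm n 1 i]
  exact htp (n + i)

omit [CharZero F] [Fact p.Prime] [Fact (¬ IsUnit (p : integerC F))]
  [IsAdicComplete (Ideal.span {(p : integerC F)}) (integerC F)] in
/-- `σ` commutes with shifting. [cite: FontaineAsterisque223III, Exp. II §1.2] -/
theorem galSeq_shiftSeq (σ : absoluteGaloisGroup F) (t : ℕ → (maxNilIdealC F).toIdeal) (i : ℕ) :
    galSeq F σ (shiftSeq F t i) = shiftSeq F (galSeq F σ t) i := rfl

/-- **`Tᵢ = [t⁽ⁱ⁾] ∈ 𝔸_inf(F)`**, Fontaine's element of the shifted sequence. [cite: FontaineAsterisque223III, Exp. II §1.2.2] -/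
def torsionLiftShift (hθ : Function.Surjective (fontaineTheta (integerC F) p)) (t : ℕ → (maxNilIdealC F).toIdeal)
    (htp : ∀ n, mulPC F p W (t (n + 1)) = t n) (i : ℕ) : AinfTop F p :=
  torsionLift W hθ (shiftSeq F t i) (shiftSeq_compat W htp i)

/-- `θ` of a Fontaine limit all of whose approximants have the same `θ`-value `c` is `c` (continuity of `θ`).
[cite: FontaineAsterisque223III, Exp. II §1.2.2] -/
theorem theta_flim_eq_of_forall {φ : (nilTheta F p hθ).toIdeal → (nilTheta F p hθ).toIdeal} (hφ : IsContracting hθ φ)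
    {u : ℕ → (nilTheta F p hθ).toIdeal}
    (hu : ∀ n, ((φ (u (n + 1)) : (nilTheta F p hθ).toIdeal) : AinfTop F p) - u n ∈ (WithIdeal.i : Ideal (AinfTop F p)))
    {c : CBall F} (hc : ∀ n, theta F p (approx φ u n) = c) : theta F p (flim hφ u hu) = c := by
  have h1 : Tendsto (fun n => theta F p (approx φ u n)) atTop (𝓝 (theta F p (flim hφ u hu))) :=
    ((continuous_theta (F := F) (p := p)).tendsto (flim hφ u hu)).comp (tendsto_approx_flim hφ hu)
  have h2 : (fun n => theta F p (approx φ u n)) = fun _ => c := funext hc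
  rw [h2] at h1
  exact (tendsto_nhds_unique tendsto_const_nhds h1).symm

/-- **`θ(Tᵢ) = uᵢ`** (`θ([pⁿ]û_{n+i}) = [pⁿ]u_{n+i} = uᵢ` for all `n`). [cite: FontaineAsterisque223III, Exp. II §1.2.2] -/
theorem theta_torsionLiftShift {t : ℕ → (maxNilIdealC F).toIdeal} (htp : ∀ n, mulPC F p W (t (n + 1)) = t n) (i : ℕ) :
    theta F p (torsionLiftShift W hθ t htp i) = t i := by
  rw [torsionLiftShift, torsionLift]
  refine theta_flim_eq_of_forall _ _ fun n => ?_
  rw [approx_def, theta_mulP_iterate]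
  have h : (⟨theta F p (lift hθ (shiftSeq F t i) n : AinfTop F p), theta_mem_maxNilIdealC (lift hθ (shiftSeq F t i) n).2⟩ :
      (maxNilIdealC F).toIdeal) = shiftSeq F t i (0 + n) := Subtype.ext (by rw [zero_add]; exact theta_lift (shiftSeq F t i) n)
  rw [h, mulPC_iterate_eq W (shiftSeq_compat W htp i) 0 n]
  show ((t (0 + i) : (maxNilIdealC F).toIdeal) : CBall F) = t i
  rw [Nat.zero_add]

/-- `Tᵢ ∈ 𝔫 = θ⁻¹(𝔪_{ℂ_F})`. [cite: FontaineAsterisque223III, Exp. II §1.2.2] -/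
theorem torsionLiftShift_mem_nilTheta {t : ℕ → (maxNilIdealC F).toIdeal} (htp : ∀ n, mulPC F p W (t (n + 1)) = t n) (i : ℕ) :
    torsionLiftShift W hθ t htp i ∈ (nilTheta F p hθ).toIdeal := by
  rw [mem_nilTheta_iff, theta_torsionLiftShift]
  exact (t i).2

/-- `Tᵢ` as a point of `𝔫`. [cite: FontaineAsterisque223III, Exp. II §1.2.2] -/
def torsionLiftShiftPt (hθ : Function.Surjective (fontaineTheta (integerC F) p)) (t : ℕ → (maxNilIdealC F).toIdeal)
    (htp : ∀ n, mulPC F p W (t (n + 1)) = t n) (i : ℕ) : (nilTheta F p hθ).toIdeal :=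
  ⟨torsionLiftShift W hθ t htp i, torsionLiftShift_mem_nilTheta W htp i⟩

/-- Unfolding. [cite: FontaineAsterisque223III, Exp. II §1.2.2] -/
@[simp] theorem coe_torsionLiftShiftPt {t : ℕ → (maxNilIdealC F).toIdeal} (htp : ∀ n, mulPC F p W (t (n + 1)) = t n) (i : ℕ) :
    ((torsionLiftShiftPt W hθ t htp i : (nilTheta F p hθ).toIdeal) : AinfTop F p) = torsionLiftShift W hθ t htp i := rfl

/-- `T₀ = [t]`. [cite: FontaineAsterisque223III, Exp. II §1.2.2] -/
theorem torsionLiftShift_zero {t : ℕ → (maxNilIdealC F).toIdeal} (htp : ∀ n, mulPC F p W (t (n + 1)) = t n) :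
    torsionLiftShift W hθ t htp 0 = torsionLift W hθ t htp := rfl

/-- **`[p]T_{i+1} = Tᵢ`**: `[p]` maps Fontaine's element of `t⁽ⁱ⁺¹⁾` to that of `t⁽ⁱ⁾` (contraction of `[p]` and independence of
the lifts). [cite: FontaineAsterisque223III, Exp. II §1.2.2] -/
theorem mulP_torsionLiftShiftPt {t : ℕ → (maxNilIdealC F).toIdeal} (htp : ∀ n, mulPC F p W (t (n + 1)) = t n) (i : ℕ) :
    (mulP W (torsionLiftShiftPt W hθ t htp (i + 1)) : AinfTop F p) = torsionLiftShift W hθ t htp i := by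
  -- lifts `vₙ` of `u_{n+i+1}`; `u'ₙ := [p]vₙ` lifts `u_{n+i}`
  set v := lift hθ (shiftSeq F t (i + 1)) with hv
  have hvθ : ∀ n, theta F p (v n : AinfTop F p) = shiftSeq F t (i + 1) n := theta_lift _
  have hv' : ∀ n, ((mulP W (v (n + 1)) : (nilTheta F p hθ).toIdeal) : AinfTop F p) - v n ∈ (WithIdeal.i : Ideal (AinfTop F p)) :=
    mulP_lift_sub_mem W (shiftSeq_compat W htp (i + 1)) hvθ
  set u' : ℕ → (nilTheta F p hθ).toIdeal := fun n => mulP W (v n) with hu'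
  have hu'θ : ∀ n, theta F p (u' n : AinfTop F p) = shiftSeq F t i n := fun n => by
    show theta F p (mulP W (v n) : AinfTop F p) = t (n + i)
    rw [theta_mulP, ← htp (n + i)]
    congr 2
    exact Subtype.ext (by
      show theta F p (v n : AinfTop F p) = ((t (n + i + 1) : (maxNilIdealC F).toIdeal) : CBall F)
      rw [hvθ n]; rfl)
  have hu'' : ∀ n, ((mulP W (u' (n + 1)) : (nilTheta F p hθ).toIdeal) : AinfTop F p) - u' n ∈ (WithIdeal.i : Ideal (AinfTop F p)) :=
    mulP_lift_sub_mem W (shiftSeq_compat W htp i) hu'θ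
  -- `Tᵢ = flim u'` by independence of the lifts
  rw [torsionLiftShift, torsionLift_eq_flim W (shiftSeq_compat W htp i) hu'θ]
  -- `[p]T_{i+1}` satisfies the characterisation of `flim u'`
  refine eq_flim_of_forall_sub_mem (isContracting_mulP (hθ := hθ) W) hu'' fun n => ?_
  have h1 : (torsionLiftShift W hθ t htp (i + 1)) - approx (mulP W) v n ∈ (WithIdeal.i ^ (n + 1) : Ideal (AinfTop F p)) :=
    flim_sub_approx_mem (isContracting_mulP (hθ := hθ) W) hv' n
  have h2 := isContracting_mulP (hθ := hθ) W n (torsionLiftShiftPt W hθ t htp (i + 1))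
    ((mulP W)^[n] (v n)) h1
  have h3 : approx (mulP W) u' n = ((mulP W ((mulP W)^[n] (v n)) : (nilTheta F p hθ).toIdeal) : AinfTop F p) := by
    rw [approx_def, show u' n = mulP W (v n) from rfl, ← Function.iterate_succ_apply, Function.iterate_succ_apply']
  rw [h3]
  exact Ideal.pow_le_pow_right (Nat.le_succ _) h2

/-- **`σ(Tᵢ) = Tᵢ(σt)`.** [cite: FontaineAsterisque223III, Exp. II §1.2] -/
theorem gal_torsionLiftShift (σ : absoluteGaloisGroup F) {t : ℕ → (maxNilIdealC F).toIdeal}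
    (htp : ∀ n, mulPC F p W (t (n + 1)) = t n) (i : ℕ) :
    gal F p σ (torsionLiftShift W hθ t htp i) =
      torsionLiftShift W hθ (galSeq F σ t) (mulPC_galSeq W hθ σ htp) i := by
  rw [torsionLiftShift, gal_torsionLift W σ]
  rfl

/-! ## §4 The correction `Σ_{i≥1} p^{i−1} R_p(Tᵢ) ∈ 𝔸_inf` -/

/-- `R_p(Tᵢ) ∈ 𝔸_inf` (integral series at a point of `𝔫`). [cite: Colmez1992PeriodesAbeliennes, §2] -/
def mulDefectAt (hθ : Function.Surjective (fontaineTheta (integerC F) p)) (t : ℕ → (maxNilIdealC F).toIdeal)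
    (htp : ∀ n, mulPC F p W (t (n + 1)) = t n) (i : ℕ) : AinfTop F p :=
  (evalPt₁ (nilTheta F p hθ) (mulDefectInt W p) (constantCoeff_mulDefectInt W p) (torsionLiftShiftPt W hθ t htp i) : AinfTop F p)

/-- The partial sums `Sₙ = Σ_{i<n} pⁱ R_p(T_{i+1})`. [cite: Colmez1992PeriodesAbeliennes, §2] -/
def etaCorrPartial (hθ : Function.Surjective (fontaineTheta (integerC F) p)) (t : ℕ → (maxNilIdealC F).toIdeal)
    (htp : ∀ n, mulPC F p W (t (n + 1)) = t n) (n : ℕ) : AinfTop F p :=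
  ∑ i ∈ Finset.range n, (p : AinfTop F p) ^ i * mulDefectAt W hθ t htp (i + 1)

/-- `S_{n+2} − S_{n+1} = p^{n+1}R_p(T_{n+2}) ∈ (p, ξ)^{n+1}`. [cite: Colmez1992PeriodesAbeliennes, §2] -/
theorem etaCorrPartial_succ_sub_mem {t : ℕ → (maxNilIdealC F).toIdeal} (htp : ∀ n, mulPC F p W (t (n + 1)) = t n) (n : ℕ) :
    etaCorrPartial W hθ t htp (n + 1 + 1) - etaCorrPartial W hθ t htp (n + 1) ∈ (WithIdeal.i ^ (n + 1) : Ideal (AinfTop F p)) := by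
  rw [etaCorrPartial, Finset.sum_range_succ, ← etaCorrPartial, add_sub_cancel_left]
  refine Ideal.mul_mem_right _ _ (Ideal.pow_mem_pow ?_ _)
  rw [ideal_eq]
  exact Ideal.subset_span (by simp)

/-- **The correction `Σ_{i≥1} p^{i−1} R_p(Tᵢ) ∈ 𝔸_inf(F)`**: the `(p, ξ)`-adic limit of the partial sums (existence by completeness).
[cite: Colmez1992PeriodesAbeliennes, §2] -/
def etaCorr (hθ : Function.Surjective (fontaineTheta (integerC F) p)) (t : ℕ → (maxNilIdealC F).toIdeal)
    (htp : ∀ n, mulPC F p W (t (n + 1)) = t n) : AinfTop F p :=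
  Classical.choose (exists_lim_of_forall_sub_mem_pow_succ (f := fun n => etaCorrPartial W hθ t htp (n + 1))
    (etaCorrPartial_succ_sub_mem W htp))

/-- `etaCorr − S_{n+1} ∈ (p, ξ)^{n+1}`. [cite: Colmez1992PeriodesAbeliennes, §2] -/
theorem etaCorr_sub_partial_mem {t : ℕ → (maxNilIdealC F).toIdeal} (htp : ∀ n, mulPC F p W (t (n + 1)) = t n) (n : ℕ) :
    etaCorr W hθ t htp - etaCorrPartial W hθ t htp (n + 1) ∈ (WithIdeal.i ^ (n + 1) : Ideal (AinfTop F p)) :=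
  Classical.choose_spec (exists_lim_of_forall_sub_mem_pow_succ (f := fun n => etaCorrPartial W hθ t htp (n + 1))
    (etaCorrPartial_succ_sub_mem W htp)) n

/-- The partial sums tend to `etaCorr`. [cite: Colmez1992PeriodesAbeliennes, §2] -/
theorem tendsto_etaCorrPartial {t : ℕ → (maxNilIdealC F).toIdeal} (htp : ∀ n, mulPC F p W (t (n + 1)) = t n) :
    Tendsto (fun n => etaCorrPartial W hθ t htp (n + 1)) atTop (𝓝 (etaCorr W hθ t htp)) :=
  tendsto_of_forall_sub_mem_pow (etaCorr_sub_partial_mem W htp)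

omit [CharZero F] [IsAdicComplete (Ideal.span {(p : integerC F)}) (integerC F)] in
/-- `σ` fixes `ℤ ⊂ 𝔸_inf`. [folklore] -/
private theorem gal_algebraMap_int' (σ : absoluteGaloisGroup F) (a : ℤ) :
    gal F p σ (algebraMap ℤ (AinfTop F p) a) = algebraMap ℤ (AinfTop F p) a := by
  rw [algebraMap_int_eq, eq_intCast, map_intCast]

/-- `σ(R_p(Tᵢ)) = R_p(Tᵢ(σt))`. [cite: FontaineAsterisque223III, Exp. II §1.2] -/
theorem gal_mulDefectAt (σ : absoluteGaloisGroup F) {t : ℕ → (maxNilIdealC F).toIdeal}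
    (htp : ∀ n, mulPC F p W (t (n + 1)) = t n) (i : ℕ) :
    gal F p σ (mulDefectAt W hθ t htp i) = mulDefectAt W hθ (galSeq F σ t) (mulPC_galSeq W hθ σ htp) i := by
  rw [mulDefectAt, mulDefectAt, evalPt₁, evalPt₁]
  exact gal_evalPt σ (gal_algebraMap_int' σ) _ _ (fun _ : Unit => torsionLiftShiftPt W hθ t htp i)
    (fun _ : Unit => torsionLiftShiftPt W hθ (galSeq F σ t) (mulPC_galSeq W hθ σ htp) i)
    fun _ => gal_torsionLiftShift W σ htp i

/-- `σ(Sₙ) = Sₙ(σt)`. [cite: FontaineAsterisque223III, Exp. II §1.2] -/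
theorem gal_etaCorrPartial (σ : absoluteGaloisGroup F) {t : ℕ → (maxNilIdealC F).toIdeal}
    (htp : ∀ n, mulPC F p W (t (n + 1)) = t n) (n : ℕ) :
    gal F p σ (etaCorrPartial W hθ t htp n) = etaCorrPartial W hθ (galSeq F σ t) (mulPC_galSeq W hθ σ htp) n := by
  simp only [etaCorrPartial, map_sum, map_mul, map_pow, map_natCast, gal_mulDefectAt]

/-- **`σ(Σ p^{i−1}R_p(Tᵢ)) = Σ p^{i−1}R_p(Tᵢ(σt))`** (continuity of `σ`, uniqueness of limits).
[cite: FontaineAsterisque223III, Exp. II §1.2] -/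
theorem gal_etaCorr (σ : absoluteGaloisGroup F) {t : ℕ → (maxNilIdealC F).toIdeal}
    (htp : ∀ n, mulPC F p W (t (n + 1)) = t n) :
    gal F p σ (etaCorr W hθ t htp) = etaCorr W hθ (galSeq F σ t) (mulPC_galSeq W hθ σ htp) := by
  have h1 : Tendsto (fun n => gal F p σ (etaCorrPartial W hθ t htp (n + 1))) atTop (𝓝 (gal F p σ (etaCorr W hθ t htp))) :=
    ((continuous_gal σ).tendsto _).comp (tendsto_etaCorrPartial W htp)
  simp only [gal_etaCorrPartial] at h1
  exact tendsto_nhds_unique h1 (tendsto_etaCorrPartial W (mulPC_galSeq W hθ σ htp))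

/-! ## §5 The η-period -/

/-- **The η-period `∫_t η := η₀([t]) − ι(Σ_{i≥1} p^{i−1} R_p([t⁽ⁱ⁾])) ∈ B_dR⁺(F)`** of a `p`-power-compatible sequence of torsion
points of `Ŵ(𝒪_{ℂ_F})` — Colmez's `lim pⁿη₀(ûₙ)` in closed form (`ι : 𝔸_inf → B_dR⁺`). [cite: Colmez1992PeriodesAbeliennes, §2] -/
def etaPeriod (hθ : Function.Surjective (fontaineTheta (integerC F) p)) (t : ℕ → (maxNilIdealC F).toIdeal)
    (ht0 : (t 0 : CBall F) = 0) (htp : ∀ n, mulPC F p W (t (n + 1)) = t n) : BdRPlusTop F p :=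
  etaPeriodMain W hθ t ht0 htp - BdRPlusTop.ofAinf F p ((of F p).symm (etaCorr W hθ t htp))

/-- **`Γ_F`-equivariance of the η-period: `σ(∫_t η) = ∫_{σt} η`.** [cite: Colmez1992PeriodesAbeliennes, §2]
[cite: FontaineAsterisque223III, Exp. II §1.5.4] -/
theorem gal_etaPeriod (σ : absoluteGaloisGroup F) {t : ℕ → (maxNilIdealC F).toIdeal} (ht0 : (t 0 : CBall F) = 0)
    (htp : ∀ n, mulPC F p W (t (n + 1)) = t n) :
    BdRPlusTop.gal F p σ (etaPeriod W hθ t ht0 htp) =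
      etaPeriod W hθ (galSeq F σ t) (coe_galSeq_zero σ ht0) (mulPC_galSeq W hθ σ htp) := by
  rw [etaPeriod, etaPeriod, map_sub, gal_etaPeriodMain, BdRPlusTop.gal_ofAinf, ← gal_etaCorr W σ htp]
  rfl

end AinfTop

end Literature.NumberTheory.PAdicHodge

end
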